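import Summits.BirchSwinnertonDyer.BirchSwinnertonDyer.Theorems.ByReductionTypeAtTwoFineSelmerConjAAtTwoAdditivePotGoodClassNumberOne780
import HarnessLib

/-!
# Route `ByReductionTypeAtTwo` (rung K4), crux C1″ `FineSelmerConjAAtTwoAdditivePotGood` (item stmt-BirchSwinnertonDyer-22615):
# A GENERIC CLASS-NUMBER-ONE CRITERION FOR CUBIC FIELDS — one norm-`ℓ` generator per (prime `ℓ` below the Minkowski bound, root
# `a` of the cubic mod `ℓ`) ⟹ `h_K = 1`; the cases `N(P) = ℓ²` and `N(P) = ℓ³` are discharged ONCE here, so that a field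
# certificate is a list of integer triples checked by `norm_num`
# (a `--supports 22615` toolkit file; seat `bsd-2adic-k4-w1` GEN 6; sequel of `…ExplicitMinkowski` (GEN 4), consumed by the per-field
# files `…ClassNumberOne<d>.lean` of GEN 6)

HONEST FRAMING (cell `bsd-2adic`, D-0036/D-0054): UNCONDITIONAL kernel lemmas about cubic number fields; closes nothing; nothing
booked; BSD is not proved by any of this. Purpose: the census rows of C1″ whose only displayed datum is the parity of `h(ℚ(P))`
(`ℚ(P)` the cubic `2`-torsion point field) are upgraded to «(A)₂ modulo Lim 2017 Thm. 3.5 ALONE» by a KERNEL proof of `h = 1`; GEN 4/5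
proved four such certificates (`d = −780, 1257, −2892, 6453`) by hand-rolled case analyses over all norms `< M_K`. Here the case
analysis is done once and for all:

* `norm_coords_eq_normPoly` — `N(x + yθ + zθ²)` as the explicit integer norm form of `X³ + pX² + qX + r` (the companion determinant
  of `…ExplicitMinkowski.norm_coords_eq_det`, expanded).
* `exists_prime_natCast_mem` — a non-zero prime `P` of `𝓞 K` contains a rational prime `ℓ` with `N(P) ∈ {ℓ, ℓ², ℓ³}` (cubic `K`).
* `isPrincipal_of_absNorm_eq_prime` — `N(I) = ℓ` prime: `θ ≡ a (mod I)` for a root `a` of the cubic mod `ℓ`, and a triple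
  `(x, y, z)` with `ℓ ∣ x + ya + za²`, `|N(x + yθ + zθ²)| = ℓ` generates `I`.
* `isPrincipal_of_absNorm_eq_prime_sq` — `N(P) = ℓ²`, `ℓ ∈ P`: `(ℓ) = P · J` with `N(J) = ℓ`, so `J = (α)`, `ℓ = αβ` and `P = (β)`.
* `classNumber_eq_one_of_normCertificate` — **the criterion**: if `M_K < B` and for every prime `ℓ < B` and every `a < ℓ` with
  `ℓ ∣ a³ + pa² + qa + r` some `(x, y, z) ∈ ℤ³` has `ℓ ∣ x + ya + za²` and `|normPoly(x, y, z)| = ℓ`, then `h_K = 1`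
  (`N(P) = ℓ³` forces `P = (ℓ)`). No Dedekind–Kummer hypothesis and no index condition is needed: the statement is about ideals of
  prime norm only, and `𝓞/I ≅ 𝔽_ℓ` for ANY ideal of prime norm.
* `card_classGroup_adjoin_eq_one_of_forall_cubicField` — transport to `ℚ(θ) ⊂ ℚ̄` for a root `θ` of the cubic (the currency of the
  census stamps).

References: [Marcus1977] Ch. 5, Thm. 35–37 and Cor. 2 (class number from the primes below the Minkowski bound); [Cohen1993] §4.8.2,
§6.3 (prime ideals of degree one `(ℓ, θ − a)` and their generators); [Neukirch1999] I.§6.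
-/

set_option autoImplicit false
-- sibling precedent (`…ClassNumberOne780.lean`): the directory name repeats the summit name
set_option linter.dupNamespace false

noncomputable section

open scoped Classical IntermediateField NumberField Real nonZeroDivisors

namespace Summit.BirchSwinnertonDyer.BirchSwinnertonDyer.Theorems.AddKatoTwo

open Polynomial IsDedekindDomain NumberField Matrix

variable (K : Type) [Field K] [NumberField K]

/-! ## §1 The norm form -/

/-- **The norm form of `ℤ[θ]`**: for a root `θ ∈ 𝓞 K` of the irreducible `X³ + pX² + qX + r` (`K` cubic),
`N(x + yθ + zθ²) = x³ − p x²y + (p² − 2q) x²z + q xy² + (3r − pq) xyz + (q² − 2pr) xz² − r y³ + pr y²z − qr yz² + r² z³`.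
[cite: Marcus1977, Ch. 2 Thm. 4 and Exercise 13] -/
theorem norm_coords_eq_normPoly (h3 : Module.finrank ℚ K = 3) (b : 𝓞 K) {p q r : ℤ}
    (hirr : Irreducible (Cubic.toPoly ⟨1, (p : ℚ), q, r⟩)) (hb : b ^ 3 + p * b ^ 2 + q * b + r = 0) (x y z : ℤ) :
    Algebra.norm ℤ ((x : 𝓞 K) + y * b + z * b ^ 2) =
      x ^ 3 - p * x ^ 2 * y + (p ^ 2 - 2 * q) * x ^ 2 * z + q * x * y ^ 2 + (3 * r - p * q) * x * y * z
        + (q ^ 2 - 2 * p * r) * x * z ^ 2 - r * y ^ 3 + p * r * y ^ 2 * z - q * r * y * z ^ 2 + r ^ 2 * z ^ 3 := by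
  have h := norm_coords_eq_det K h3 b hirr hb x y z
  have hdet : ((x : ℚ) • (1 : Matrix (Fin 3) (Fin 3) ℚ) + (y : ℚ) • !![(0 : ℚ), 0, -r; 1, 0, -q; 0, 1, -p] +
        (z : ℚ) • !![(0 : ℚ), 0, -r; 1, 0, -q; 0, 1, -p] ^ 2).det =
      ((x ^ 3 - p * x ^ 2 * y + (p ^ 2 - 2 * q) * x ^ 2 * z + q * x * y ^ 2 + (3 * r - p * q) * x * y * z
        + (q ^ 2 - 2 * p * r) * x * z ^ 2 - r * y ^ 3 + p * r * y ^ 2 * z - q * r * y * z ^ 2 + r ^ 2 * z ^ 3 : ℤ) : ℚ) := by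
    simp only [Matrix.one_fin_three, Matrix.det_fin_three, Matrix.add_apply, Matrix.smul_apply, sq, Matrix.mul_apply,
      Fin.sum_univ_three, Matrix.of_apply, Matrix.cons_val', Matrix.cons_val_zero, Matrix.cons_val_one, Matrix.cons_val_two,
      Matrix.empty_val', Matrix.cons_val_fin_one, smul_eq_mul, Matrix.vecHead, Matrix.vecTail, Function.comp_apply,
      Fin.succ_zero_eq_one]
    push_cast
    ring
  rw [hdet] at h
  exact_mod_cast h

/-- Integer form of `norm_coords_eq_normPoly`: **`|N(x + yθ + zθ²)| = |normPoly(x, y, z)|`**. [cite: Marcus1977, Ch. 2 Thm. 4] -/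
theorem natAbs_norm_coords_eq_natAbs_normPoly (h3 : Module.finrank ℚ K = 3) (b : 𝓞 K) {p q r : ℤ}
    (hirr : Irreducible (Cubic.toPoly ⟨1, (p : ℚ), q, r⟩)) (hb : b ^ 3 + p * b ^ 2 + q * b + r = 0) (x y z : ℤ) :
    (Algebra.norm ℤ ((x : 𝓞 K) + y * b + z * b ^ 2)).natAbs =
      (x ^ 3 - p * x ^ 2 * y + (p ^ 2 - 2 * q) * x ^ 2 * z + q * x * y ^ 2 + (3 * r - p * q) * x * y * z
        + (q ^ 2 - 2 * p * r) * x * z ^ 2 - r * y ^ 3 + p * r * y ^ 2 * z - q * r * y * z ^ 2 + r ^ 2 * z ^ 3).natAbs := by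
  rw [norm_coords_eq_normPoly K h3 b hirr hb]

/-! ## §2 The rational prime below a prime ideal -/

/-- **A non-zero prime `P` of `𝓞 K` contains a rational prime `ℓ`, and then `N(P) = ℓ^i` with `1 ≤ i ≤ 3`** (`K` cubic:
`N(P) ∣ N(ℓ) = ℓ³`, `N(P) ≠ 1`). [cite: Marcus1977, Ch. 3 Thm. 21–22] -/
theorem exists_prime_natCast_mem (h3 : Module.finrank ℚ K = 3) {P : Ideal (𝓞 K)} (hP : P.IsPrime) (hP0 : P ≠ ⊥) :
    ∃ ℓ : ℕ, ℓ.Prime ∧ ((ℓ : ℕ) : 𝓞 K) ∈ P ∧ ∃ i : ℕ, 1 ≤ i ∧ i ≤ 3 ∧ Ideal.absNorm P = ℓ ^ i := by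
  -- the rational prime under `P` (as in `Literature.…ClassGroupCertDK.classIn_of_absNorm_dvd`)
  obtain ⟨ℓ, hℓ, hℓP⟩ : ∃ ℓ : ℕ, ℓ.Prime ∧ ((ℓ : ℕ) : 𝓞 K) ∈ P := by
    obtain ⟨g, hg⟩ := IsPrincipalIdealRing.principal <| Ideal.under ℤ P
    have hg0 : g ≠ 0 := fun h' => hP0 <| Ideal.eq_bot_of_comap_eq_bot (R := ℤ) <| by
      simpa only [hg, Ideal.submodule_span_eq, Ideal.span_singleton_eq_bot]
    have hgprime := (Ideal.span_singleton_prime hg0).mp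
    simp only [← Ideal.submodule_span_eq, ← hg] at hgprime
    have hgmem : (g : 𝓞 K) ∈ P := by
      have : g ∈ Ideal.under ℤ P := by rw [hg]; exact Ideal.mem_span_singleton_self g
      simpa [Ideal.under_def, Ideal.mem_comap] using this
    refine ⟨g.natAbs, Int.prime_iff_natAbs_prime.mp (hgprime (hP.under _)), ?_⟩
    rw [← Int.cast_natCast]
    rcases Int.natAbs_eq g with h' | h'
    · rw [← h']; exact hgmem
    · rw [show ((g.natAbs : ℕ) : ℤ) = -g by omega, Int.cast_neg]; exact P.neg_mem_iff.mpr hgmem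
  refine ⟨ℓ, hℓ, hℓP, ?_⟩
  have hdvd := absNorm_dvd_pow_three_of_natCast_mem K h3 hℓP
  obtain ⟨i, hi3, hi⟩ := (Nat.dvd_prime_pow hℓ).mp hdvd
  refine ⟨i, ?_, hi3, hi⟩
  by_contra h0
  have hi0 : i = 0 := by omega
  rw [hi0, pow_zero, Ideal.absNorm_eq_one_iff] at hi
  exact hP.ne_top hi

/-! ## §3 Ideals of norm `ℓ` and `ℓ²` -/

omit [NumberField K] in
/-- **`x + yθ + zθ² ∈ I`** as soon as `θ − a ∈ I`, `ℓ ∈ I` and `ℓ ∣ x + ya + za²` (`x + yθ + zθ² = (x + ya + za²) + (θ − a)(y + z(θ + a))`).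
[folklore] -/
theorem coords_mem_of_dvd {I : Ideal (𝓞 K)} {b : 𝓞 K} {ℓ a : ℕ} (hℓ : ((ℓ : ℕ) : 𝓞 K) ∈ I) (hba : b - (a : 𝓞 K) ∈ I)
    {x y z : ℤ} (hdvd : (ℓ : ℤ) ∣ x + y * a + z * (a : ℤ) ^ 2) : ((x : 𝓞 K) + y * b + z * b ^ 2) ∈ I := by
  obtain ⟨k, hk⟩ := hdvd
  have hk' : ((x : ℤ) : 𝓞 K) + y * (a : 𝓞 K) + z * (a : 𝓞 K) ^ 2 = ((ℓ : ℕ) : 𝓞 K) * (k : 𝓞 K) := by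
    have := congrArg (Int.cast (R := 𝓞 K)) hk
    push_cast at this
    exact this
  have : ((x : 𝓞 K) + y * b + z * b ^ 2) = ((ℓ : ℕ) : 𝓞 K) * (k : 𝓞 K) + (b - (a : 𝓞 K)) * (y + z * (b + a)) := by
    linear_combination hk'
  rw [this]
  exact I.add_mem (I.mul_mem_right _ hℓ) (I.mul_mem_right _ hba)

/-- **An ideal of prime norm `ℓ` is principal, given a norm-`ℓ` generator for each root of the cubic mod `ℓ`**: `𝓞/I ≅ 𝔽_ℓ`, so
`θ ≡ a (mod I)` with `ℓ ∣ g(a)`; the certificate triple for `(ℓ, a)` lies in `I` and has norm `± ℓ = ± N(I)`, hence generates `I`.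
[cite: Marcus1977, Ch. 5 Thm. 37 and the worked examples after Cor. 2] [cite: Cohen1993, §4.8.2] -/
theorem isPrincipal_of_absNorm_eq_prime (h3 : Module.finrank ℚ K = 3) (b : 𝓞 K) {p q r : ℤ}
    (hirr : Irreducible (Cubic.toPoly ⟨1, (p : ℚ), q, r⟩)) (hb : b ^ 3 + p * b ^ 2 + q * b + r = 0)
    {ℓ : ℕ} (hℓ : ℓ.Prime)
    (hcert : ∀ a : ℕ, a < ℓ → (ℓ : ℤ) ∣ (a : ℤ) ^ 3 + p * (a : ℤ) ^ 2 + q * a + r →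
      ∃ x y z : ℤ, (ℓ : ℤ) ∣ x + y * a + z * (a : ℤ) ^ 2 ∧
        (x ^ 3 - p * x ^ 2 * y + (p ^ 2 - 2 * q) * x ^ 2 * z + q * x * y ^ 2 + (3 * r - p * q) * x * y * z
          + (q ^ 2 - 2 * p * r) * x * z ^ 2 - r * y ^ 3 + p * r * y ^ 2 * z - q * r * y * z ^ 2 + r ^ 2 * z ^ 3).natAbs = ℓ)
    {I : Ideal (𝓞 K)} (hI : Ideal.absNorm I = ℓ) : ∃ α : 𝓞 K, I = Ideal.span {α} := by
  have hℓI : ((ℓ : ℕ) : 𝓞 K) ∈ I := by have := Ideal.absNorm_mem I; rwa [hI] at this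
  obtain ⟨a, ha, hab⟩ := exists_sub_natCast_mem_of_absNorm_eq_prime K hℓ hI b
  have hroot := natCast_dvd_of_sub_mem K hℓ hI h3 hb hab
  obtain ⟨x, y, z, hdvd, hN⟩ := hcert a ha hroot
  refine ⟨_, eq_span_singleton_of_mem_of_absNorm_eq K hℓ.ne_zero hI (coords_mem_of_dvd K hℓI hab hdvd) ?_⟩
  rw [natAbs_norm_coords_eq_natAbs_normPoly K h3 b hirr hb, hN]

/-- **A prime ideal above `ℓ` of norm `ℓ²` is principal once every ideal of norm `ℓ` is**: `(ℓ) = P · J` with `N(J) = ℓ³/ℓ² = ℓ`,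
so `J = (α)`, then `ℓ ∈ (α)` gives `ℓ = αβ` and cancelling `(α) ≠ 0` in `P · (α) = (α)(β)` gives `P = (β)`.
[cite: Marcus1977, Ch. 5 Thm. 37] [cite: Neukirch1999, I.§3 (unique factorisation of ideals, cancellation)] -/
theorem isPrincipal_of_absNorm_eq_prime_sq (h3 : Module.finrank ℚ K = 3) {ℓ : ℕ} (hℓ : ℓ.Prime)
    (hone : ∀ J : Ideal (𝓞 K), Ideal.absNorm J = ℓ → ∃ α : 𝓞 K, J = Ideal.span {α})
    {P : Ideal (𝓞 K)} (hℓP : ((ℓ : ℕ) : 𝓞 K) ∈ P) (hP : Ideal.absNorm P = ℓ ^ 2) : ∃ β : 𝓞 K, P = Ideal.span {β} := by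
  obtain ⟨J, hJ⟩ : P ∣ Ideal.span {((ℓ : ℕ) : 𝓞 K)} := Ideal.dvd_iff_le.mpr ((Ideal.span_singleton_le_iff_mem P).mpr hℓP)
  have hNℓ : Ideal.absNorm (Ideal.span {((ℓ : ℕ) : 𝓞 K)}) = ℓ ^ 3 := by
    rw [Ideal.absNorm_span_singleton]
    have : ((ℓ : ℕ) : 𝓞 K) = algebraMap ℤ (𝓞 K) ℓ := by simp
    rw [this, Algebra.norm_algebraMap, NumberField.RingOfIntegers.rank, h3, Int.natAbs_pow]
    simp
  have hJN : Ideal.absNorm J = ℓ := by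
    have h := congrArg Ideal.absNorm hJ
    rw [hNℓ, map_mul, hP, pow_succ] at h
    exact (Nat.eq_of_mul_eq_mul_left (pow_pos hℓ.pos 2) h).symm
  obtain ⟨α, hα⟩ := hone J hJN
  have hℓmem : ((ℓ : ℕ) : 𝓞 K) ∈ Ideal.span {α} := by
    have : ((ℓ : ℕ) : 𝓞 K) ∈ P * J := by rw [← hJ]; exact Ideal.mem_span_singleton_self _
    rw [hα] at this
    exact Ideal.mul_le_left this
  obtain ⟨β, hβ⟩ := Ideal.mem_span_singleton'.mp hℓmem
  have hα0 : α ≠ 0 := by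
    intro h0
    rw [h0] at hα
    have := hJN
    rw [hα, Ideal.span_singleton_eq_bot.mpr rfl, Ideal.absNorm_bot] at this
    exact hℓ.ne_zero this.symm
  refine ⟨β, ?_⟩
  have key : P * Ideal.span {α} = Ideal.span {β} * Ideal.span {α} := by
    rw [Ideal.span_singleton_mul_span_singleton, hβ, ← hα, ← hJ]
  exact mul_right_cancel₀ ((Ideal.span_singleton_eq_bot.not).mpr hα0) key

/-! ## §4 The criterion -/

/-- **CLASS NUMBER ONE FROM A NORM CERTIFICATE (cubic fields).** Let `K` be a cubic number field, `θ ∈ 𝓞 K` a root of the irreducible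
`X³ + pX² + qX + r ∈ ℤ[X]`, and `B ∈ ℕ` above the Minkowski bound `M_K`. Suppose that for every prime `ℓ < B` and every `a < ℓ` with
`ℓ ∣ a³ + pa² + qa + r` there are `x, y, z ∈ ℤ` with `ℓ ∣ x + ya + za²` and `|normPoly(x, y, z)| = ℓ`. Then `h_K = 1`: every prime `P`
with `N(P) ≤ M_K` lies over some `ℓ < B` with `N(P) ∈ {ℓ, ℓ², ℓ³}` (§2) and is principal by §3 (`N = ℓ, ℓ²`) or equals `(ℓ)` (`N = ℓ³`);
Mathlib's `RingOfIntegers.isPrincipalIdealRing_of_isPrincipal_of_norm_le_of_isPrime` concludes. KERNEL, no index / Dedekind–Kummer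
hypothesis. [cite: Marcus1977, Ch. 5 Thm. 35–37 and Cor. 2] [cite: Cohen1993, §6.3] -/
theorem classNumber_eq_one_of_normCertificate (h3 : Module.finrank ℚ K = 3) (b : 𝓞 K) {p q r : ℤ}
    (hirr : Irreducible (Cubic.toPoly ⟨1, (p : ℚ), q, r⟩)) (hb : b ^ 3 + p * b ^ 2 + q * b + r = 0) {B : ℕ}
    (hM : (4 / π) ^ NumberField.InfinitePlace.nrComplexPlaces K *
      ((Module.finrank ℚ K).factorial / (Module.finrank ℚ K : ℝ) ^ Module.finrank ℚ K * √|(NumberField.discr K : ℝ)|) < B)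
    (hcert : ∀ ℓ : ℕ, ℓ < B → ℓ.Prime → ∀ a : ℕ, a < ℓ → (ℓ : ℤ) ∣ (a : ℤ) ^ 3 + p * (a : ℤ) ^ 2 + q * a + r →
      ∃ x y z : ℤ, (ℓ : ℤ) ∣ x + y * a + z * (a : ℤ) ^ 2 ∧
        (x ^ 3 - p * x ^ 2 * y + (p ^ 2 - 2 * q) * x ^ 2 * z + q * x * y ^ 2 + (3 * r - p * q) * x * y * z
          + (q ^ 2 - 2 * p * r) * x * z ^ 2 - r * y ^ 3 + p * r * y ^ 2 * z - q * r * y * z ^ 2 + r ^ 2 * z ^ 3).natAbs = ℓ) :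
    NumberField.classNumber K = 1 := by
  rw [NumberField.classNumber_eq_one_iff]
  refine RingOfIntegers.isPrincipalIdealRing_of_isPrincipal_of_norm_le_of_isPrime fun I hI hle ↦ ?_
  have hlt : Ideal.absNorm (I : Ideal (𝓞 K)) < B := by exact_mod_cast hle.trans_lt hM
  have hI0 : (I : Ideal (𝓞 K)) ≠ ⊥ := nonZeroDivisors.coe_ne_zero I
  obtain ⟨ℓ, hℓ, hℓI, i, hi1, hi3, hN⟩ := exists_prime_natCast_mem K h3 hI hI0
  have hℓB : ℓ < B := by
    refine lt_of_le_of_lt ?_ hlt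
    rw [hN]
    exact Nat.le_self_pow (by omega) ℓ
  have hone : ∀ J : Ideal (𝓞 K), Ideal.absNorm J = ℓ → ∃ α : 𝓞 K, J = Ideal.span {α} := fun J hJ =>
    isPrincipal_of_absNorm_eq_prime K h3 b hirr hb hℓ (hcert ℓ hℓB hℓ) hJ
  interval_cases i
  · -- `N(I) = ℓ`
    rw [pow_one] at hN
    obtain ⟨α, hα⟩ := hone _ hN
    exact ⟨⟨α, by rw [hα]⟩⟩
  · -- `N(I) = ℓ²`
    obtain ⟨β, hβ⟩ := isPrincipal_of_absNorm_eq_prime_sq K h3 hℓ hone hℓI hN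
    exact ⟨⟨β, by rw [hβ]⟩⟩
  · -- `N(I) = ℓ³ = N((ℓ))`, so `I = (ℓ)`
    have hnorm : (Algebra.norm ℤ ((ℓ : ℕ) : 𝓞 K)).natAbs = ℓ ^ 3 := by
      have : ((ℓ : ℕ) : 𝓞 K) = algebraMap ℤ (𝓞 K) ℓ := by simp
      rw [this, Algebra.norm_algebraMap, NumberField.RingOfIntegers.rank, h3, Int.natAbs_pow]
      simp
    exact ⟨⟨_, by rw [eq_span_singleton_of_mem_of_absNorm_eq K (pow_ne_zero 3 hℓ.ne_zero) hN hℓI hnorm]⟩⟩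

/-! ## §5 Transport to `ℚ(θ) ⊂ ℚ̄` -/

/-- **`#Cl(𝓞 ℚ(θ)) = 1`** for a root `θ ∈ ℚ̄` of an irreducible `X³ + pX² + qX + r ∈ ℤ[X]`, from `h = 1` for EVERY cubic number
field whose integers contain a root (the form in which the per-field certificates are proved). [folklore] -/
theorem card_classGroup_adjoin_eq_one_of_forall_cubicField {p q r : ℤ} (hirr : Irreducible (Cubic.toPoly ⟨1, (p : ℚ), q, r⟩))
    (h : ∀ (K : Type) [Field K] [NumberField K], Module.finrank ℚ K = 3 →
      ∀ b : 𝓞 K, b ^ 3 + p * b ^ 2 + q * b + r = 0 → NumberField.classNumber K = 1)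
    {θ : AlgebraicClosure ℚ} (hθ : aeval θ (Cubic.toPoly ⟨1, (p : ℚ), q, r⟩) = 0) :
    Nat.card (ClassGroup (𝓞 (IntermediateField.adjoin ℚ {θ}))) = 1 := by
  have hfm : (Cubic.toPoly ⟨1, (p : ℚ), q, r⟩).Monic := Cubic.monic_of_a_eq_one'
  have hθint : IsIntegral ℚ θ := ⟨_, hfm, by rwa [← aeval_def]⟩
  haveI : FiniteDimensional ℚ (IntermediateField.adjoin ℚ {θ}) := IntermediateField.adjoin.finiteDimensional hθint
  haveI : NumberField (IntermediateField.adjoin ℚ {θ}) := NumberField.mk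
  obtain ⟨b, -, hb⟩ := exists_ringOfIntegers_cubic_root (p := p) (q := q) (r := r) hθ
  have h1 := h _ (finrank_adjoin_eq_three_of_irreducible hirr hθ) b hb
  rw [NumberField.classNumber, ← Nat.card_eq_fintype_card] at h1
  exact h1

/-- **`2 ∤ #Cl(𝓞 ℚ(θ))`** in the same situation — the displayed bit of the one-bit door stamps, decided. [folklore] -/
theorem not_two_dvd_card_classGroup_adjoin_of_forall_cubicField {p q r : ℤ}
    (hirr : Irreducible (Cubic.toPoly ⟨1, (p : ℚ), q, r⟩))
    (h : ∀ (K : Type) [Field K] [NumberField K], Module.finrank ℚ K = 3 →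
      ∀ b : 𝓞 K, b ^ 3 + p * b ^ 2 + q * b + r = 0 → NumberField.classNumber K = 1)
    {θ : AlgebraicClosure ℚ} (hθ : aeval θ (Cubic.toPoly ⟨1, (p : ℚ), q, r⟩) = 0) :
    ¬ 2 ∣ Nat.card (ClassGroup (𝓞 (IntermediateField.adjoin ℚ {θ}))) := by
  rw [card_classGroup_adjoin_eq_one_of_forall_cubicField hirr h hθ]; norm_num

end Summit.BirchSwinnertonDyer.BirchSwinnertonDyer.Theorems.AddKatoTwo

end
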